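import Mathlib
import Summits.NavierStokesRegularity.NavierStokesRegularity.Theorems.WakeRatchetTailRatchetQuietPastBootstrap
import Summits.NavierStokesRegularity.NavierStokesRegularity.Theorems.TransitMassLedgerActionTransitExtractionSmallAmplitudeRung
import HarnessLib

/-!
# `WakeRatchet.TailRatchet` (stmt-NavierStokesRegularity-21808) — hypothesis class of the tail ratchets:
# the UNIFORM backward amplitude floor (the past of a non-trivial eternal solution is loud at EVERY early log-time)

Support file (route `WakeRatchet`; MODEL lattice ODEs of Tao 2016 §4 / §6.4 — nothing here concerns the Navier–Stokes
equations; no item is closed).  Fifth file of the `WakeRatchetQuietPast` series.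

Iterating the bootstrap and the halving step of `…QuietPastBootstrap` over epochs of doubling length
(`δ_j = δ/2^j`, `h_j = 1/(8Kδ_j)`, epoch ends `σ₁ + (2^j − 1)/(8Kδ)`), for a uniformly bounded eternal solution of ANY table
with ANY covariant viscosity `ν̂ ≥ 0` (`K > 0` a bound of `C_Q + Λ C_A + Λ⁻¹ C_B`):

* `epochs` / `small_forever` / `decay_after` — if all shells are `≤ δ` at ONE log-time `σ₁` and `K δ ≤ 1/64`, then all
  shells are `≤ 2δ` at all later log-times and `≤ 2δ/2^j` after `σ₁ + (2^j − 1)/(8Kδ)`: smallness at one instant forces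
  DECAY TO ZERO forward in log-time (uniformly over the shells);
* `eq_zero_of_quiet_instants` — hence a solution that is quiet (`≤ 1/(64K)` in every shell) at a sequence of log-times
  tending to `−∞` is identically zero;
* `uniformly_loud_past` — **uniform backward floor**: a non-trivial uniformly bounded eternal solution has a log-time `σ₀`
  such that `sup_k ‖W_k(σ)‖ > 1/(64K)` for EVERY `σ ≤ σ₀` (strengthening `past_loud` of `…QuietPastFloor`, which gave
  loudness only at SOME arbitrarily negative log-times);
* `uniformly_loud_past_of_inTableClass` / `eventually_loud_atBot` — the class-uniform version on E₂(R), `0 < ε₀ ≤ 1`: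
  threshold `1/45056` (`K ≤ 704`, tree `quadConst_le`), also for the inviscid class `IsEternal`.

So every α-limit (any sequence of past log-times, any shell recentring at the loud shell) of a member of the hypothesis class
of stmt-21808 / 25584 / 25646 / 25647 is taken along frames of amplitude `> 1/45056`.

HONEST FRAMING: elementary real analysis for a MODEL lattice ODE; stmt-21808 is neither proved nor refuted here (dead modulo
the construction `WakeRatchetDyadicFront.DyadicScalarFronts`).
-/

noncomputable section

set_option linter.dupNamespace false

namespace Summit.NavierStokesRegularity.NavierStokesRegularity.Theorems

namespace WakeRatchetQuietPast

open Set Filter Topology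
open Literature.Analysis.FluidPDE Literature.Analysis.FluidPDE.TaoCascade
open Summit.NavierStokesRegularity.NavierStokesRegularity.Cruxes.ActionTransitExtraction.SmallAmplitudeRung
  (quadConst_le)

variable {m : ℕ} {ε₀ νh : ℝ} {α : Fin m → Fin m → Fin m → ℤ × ℤ × ℤ → ℝ} {W : ℤ → ℝ → Em m}

/-! ## Epochs of doubling length -/

/-- **Epoch induction.**  All shells `≤ δ` at `σ₁` (`0 < δ`, `K δ ≤ 1/64`, `‖W‖ ≤ C`): at the end
`σ₁ + (2^j − 1)/(8Kδ)` of the `j`-th epoch all shells are `≤ δ/2^j`, and `≤ 2δ` throughout `[σ₁, σ₁ + (2^j − 1)/(8Kδ)]`.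
[cite: Tao2016AveragedNS, §4 Lemma 4.1 (4.8), §6.4; cell theorem] -/
theorem epochs (hε : -1 < ε₀) (hW : IsEternalVisc ε₀ νh α W) {K C δ σ₁ : ℝ}
    (hK : shiftConst α (0, 0, 0) + bigLam ε₀ * shiftConst α (0, 0, 1)
      + (bigLam ε₀)⁻¹ * (shiftConst α (1, 0, 0) + shiftConst α (0, 1, 0)) ≤ K)
    (hK0 : 0 < K) (hC0 : 0 ≤ C) (hC : ∀ (j : ℤ) (σ : ℝ), ‖W j σ‖ ≤ C) (hδ : 0 < δ) (hKδ : K * δ ≤ 1 / 64)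
    (hq : ∀ k : ℤ, ‖W k σ₁‖ ≤ δ) (j : ℕ) :
    (∀ k : ℤ, ‖W k (σ₁ + (2 ^ j - 1) / (8 * K * δ))‖ ≤ δ / 2 ^ j) ∧
      (∀ (k : ℤ) (u : ℝ), u ∈ Icc σ₁ (σ₁ + (2 ^ j - 1) / (8 * K * δ)) → ‖W k u‖ ≤ 2 * δ) := by
  induction j with
  | zero =>
    simp only [pow_zero, sub_self, zero_div, add_zero, div_one]
    refine ⟨hq, fun k u hu => ?_⟩
    have : u = σ₁ := le_antisymm hu.2 hu.1
    rw [this]; linarith [hq k]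
  | succ j ih =>
    obtain ⟨ih1, ih2⟩ := ih
    have h2j : (0 : ℝ) < 2 ^ j := by positivity
    have hδj : 0 < δ / 2 ^ j := by positivity
    have hδjle : δ / 2 ^ j ≤ δ := div_le_self hδ.le (one_le_pow₀ (by norm_num))
    have hKδj : K * (δ / 2 ^ j) ≤ 1 / 64 := (mul_le_mul_of_nonneg_left hδjle hK0.le).trans hKδ
    -- the `(j+1)`-st epoch is `[e_j, e_j + 1/(8K δ_j)]`
    have hej : σ₁ + (2 ^ j - 1) / (8 * K * δ) + 1 / (8 * K * (δ / 2 ^ j))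
        = σ₁ + (2 ^ (j + 1) - 1) / (8 * K * δ) := by
      field_simp
      ring
    have hhalf := half_at_end hε hW hK hK0 hC0 hC hδj hKδj ih1
    have hboot := bootstrap_two_delta hε hW hK hC0 hC hδj.le ih1
      (by positivity : (0 : ℝ) ≤ 1 / (8 * K * (δ / 2 ^ j)))
      (by rw [show K * (δ / 2 ^ j) * (1 / (8 * K * (δ / 2 ^ j))) = 1 / 8 by field_simp])
    rw [hej] at hhalf hboot
    refine ⟨fun k => ?_, fun k u hu => ?_⟩
    · have := hhalf k
      have e1 : δ / 2 ^ (j + 1) = δ / 2 ^ j / 2 := by rw [pow_succ, div_div]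
      rw [e1]
      exact this
    · by_cases hle : u ≤ σ₁ + (2 ^ j - 1) / (8 * K * δ)
      · exact ih2 k u ⟨hu.1, hle⟩
      · push Not at hle
        have := hboot k u ⟨hle.le, hu.2⟩
        linarith [this, hδjle]

/-- **Smallness at one instant persists (factor 2).**  If all shells are `≤ δ` at `σ₁` (`0 < δ`, `K δ ≤ 1/64`), then all
shells are `≤ 2δ` at every `u ≥ σ₁`. [cite: Tao2016AveragedNS, §4 Lemma 4.1 (4.8), §6.4; cell theorem] -/
theorem small_forever (hε : -1 < ε₀) (hW : IsEternalVisc ε₀ νh α W) {K C δ σ₁ : ℝ}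
    (hK : shiftConst α (0, 0, 0) + bigLam ε₀ * shiftConst α (0, 0, 1)
      + (bigLam ε₀)⁻¹ * (shiftConst α (1, 0, 0) + shiftConst α (0, 1, 0)) ≤ K)
    (hK0 : 0 < K) (hC0 : 0 ≤ C) (hC : ∀ (j : ℤ) (σ : ℝ), ‖W j σ‖ ≤ C) (hδ : 0 < δ) (hKδ : K * δ ≤ 1 / 64)
    (hq : ∀ k : ℤ, ‖W k σ₁‖ ≤ δ) : ∀ (k : ℤ) (u : ℝ), σ₁ ≤ u → ‖W k u‖ ≤ 2 * δ := by
  intro k u hu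
  obtain ⟨j, hj⟩ := pow_unbounded_of_one_lt (1 + 8 * K * δ * (u - σ₁)) (by norm_num : (1 : ℝ) < 2)
  refine (epochs hε hW hK hK0 hC0 hC hδ hKδ hq j).2 k u ⟨hu, ?_⟩
  have hKδ0 : 0 < 8 * K * δ := by positivity
  rw [← sub_le_iff_le_add', le_div_iff₀ hKδ0]
  linarith

/-- **Decay after smallness at one instant.**  Under the same hypotheses, all shells are `≤ 2δ/2^j` at every
`u ≥ σ₁ + (2^j − 1)/(8Kδ)`. [cite: Tao2016AveragedNS, §4 Lemma 4.1 (4.8), §6.4; cell theorem] -/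
theorem decay_after (hε : -1 < ε₀) (hW : IsEternalVisc ε₀ νh α W) {K C δ σ₁ : ℝ}
    (hK : shiftConst α (0, 0, 0) + bigLam ε₀ * shiftConst α (0, 0, 1)
      + (bigLam ε₀)⁻¹ * (shiftConst α (1, 0, 0) + shiftConst α (0, 1, 0)) ≤ K)
    (hK0 : 0 < K) (hC0 : 0 ≤ C) (hC : ∀ (j : ℤ) (σ : ℝ), ‖W j σ‖ ≤ C) (hδ : 0 < δ) (hKδ : K * δ ≤ 1 / 64)
    (hq : ∀ k : ℤ, ‖W k σ₁‖ ≤ δ) (j : ℕ) :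
    ∀ (k : ℤ) (u : ℝ), σ₁ + (2 ^ j - 1) / (8 * K * δ) ≤ u → ‖W k u‖ ≤ 2 * δ / 2 ^ j := by
  intro k u hu
  have h1 := (epochs hε hW hK hK0 hC0 hC hδ hKδ hq j).1
  have hδj : 0 < δ / 2 ^ j := by positivity
  have hδjle : δ / 2 ^ j ≤ δ := div_le_self hδ.le (one_le_pow₀ (by norm_num))
  have hKδj : K * (δ / 2 ^ j) ≤ 1 / 64 := (mul_le_mul_of_nonneg_left hδjle hK0.le).trans hKδ
  have := small_forever hε hW hK hK0 hC0 hC hδj hKδj h1 k u hu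
  rw [mul_div_assoc]
  exact this

/-! ## Quiet instants in the far past force triviality; the uniform backward floor -/

/-- **Quiet instants accumulating at `−∞` force `W ≡ 0`.**  If a uniformly bounded eternal solution (any table, any
`ν̂ ≥ 0`, `K > 0` a bound of the table constant) has, before every `σ₀`, a log-time at which ALL shells are `≤ 1/(64K)`,
then it is identically zero (the decay from each quiet instant reaches any fixed `(n, σ)` with an arbitrarily small bound).
[cite: Tao2016AveragedNS, §4 Lemma 4.1 (4.8), §6.4; cell theorem] -/
theorem eq_zero_of_quiet_instants (hε : -1 < ε₀) (hW : IsEternalVisc ε₀ νh α W) (hU : UniformBound W) {K : ℝ}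
    (hK : shiftConst α (0, 0, 0) + bigLam ε₀ * shiftConst α (0, 0, 1)
      + (bigLam ε₀)⁻¹ * (shiftConst α (1, 0, 0) + shiftConst α (0, 1, 0)) ≤ K)
    (hK0 : 0 < K) (hquiet : ∀ σ₀ : ℝ, ∃ σ : ℝ, σ ≤ σ₀ ∧ ∀ k : ℤ, ‖W k σ‖ ≤ 1 / (64 * K)) :
    ∀ (n : ℤ) (σ : ℝ), W n σ = 0 := by
  obtain ⟨C, hC⟩ := hU
  have hC0 : 0 ≤ C := (norm_nonneg _).trans (hC 0 0)
  set δ : ℝ := 1 / (64 * K) with hδ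
  have hδ0 : 0 < δ := by rw [hδ]; positivity
  have hKδ : K * δ ≤ 1 / 64 := by rw [hδ, show K * (1 / (64 * K)) = 1 / 64 by field_simp]
  intro n σ
  -- `‖W n σ‖ ≤ 2δ/2^j` for every `j`
  have hall : ∀ j : ℕ, ‖W n σ‖ ≤ 2 * δ / 2 ^ j := by
    intro j
    obtain ⟨σ', hσ', hq'⟩ := hquiet (σ - (2 ^ j - 1) / (8 * K * δ))
    exact decay_after hε hW hK hK0 hC0 hC hδ0 hKδ hq' j n σ (by linarith)
  by_contra hne
  have hpos : 0 < ‖W n σ‖ := norm_pos_iff.2 hne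
  obtain ⟨j, hj⟩ := pow_unbounded_of_one_lt (2 * δ / ‖W n σ‖) (by norm_num : (1 : ℝ) < 2)
  have h1 := hall j
  have h2 : 2 * δ / 2 ^ j < ‖W n σ‖ := by
    rw [div_lt_iff₀ (by positivity)]
    rw [div_lt_iff₀ hpos] at hj
    linarith [hj]
  linarith

/-- **Uniform backward amplitude floor.**  A non-trivial uniformly bounded eternal solution of the renormalised lattice of
ANY table with ANY covariant viscosity `ν̂ ≥ 0` is loud at EVERY sufficiently early log-time: there is `σ₀` such that for
every `σ ≤ σ₀` some shell has `‖W_k(σ)‖ > 1/(64K)` (`K > 0` any bound of `C_Q + Λ C_A + Λ⁻¹ C_B`).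
[cite: Tao2016AveragedNS, §4 Lemma 4.1 (4.8)–(4.10), §6.4; cell theorem] -/
theorem uniformly_loud_past (hε : -1 < ε₀) (hW : IsEternalVisc ε₀ νh α W) (hU : UniformBound W) {K : ℝ}
    (hK : shiftConst α (0, 0, 0) + bigLam ε₀ * shiftConst α (0, 0, 1)
      + (bigLam ε₀)⁻¹ * (shiftConst α (1, 0, 0) + shiftConst α (0, 1, 0)) ≤ K)
    (hK0 : 0 < K) (hne : ∃ (n : ℤ) (σ : ℝ), W n σ ≠ 0) :
    ∃ σ₀ : ℝ, ∀ σ : ℝ, σ ≤ σ₀ → ∃ k : ℤ, 1 / (64 * K) < ‖W k σ‖ := by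
  by_contra h
  push Not at h
  obtain ⟨n, σ, hnz⟩ := hne
  exact hnz (eq_zero_of_quiet_instants hε hW hU hK hK0 h n σ)

/-! ## Class-uniform form on E₂(R) -/

/-- **Uniform backward floor, class-uniform on E₂(R).**  A non-trivial uniformly bounded admissible eternal solution of an
E₂(R) table (`0 < ε₀ ≤ 1`, any `ν̂ ≥ 0`) is loud at every sufficiently early log-time with the universal amplitude
`1/45056 = 1/(64·704)`. [cite: Tao2016AveragedNS, §4 (4.1)–(4.3), Lemma 4.1 (4.8), §6.4; cell theorem] -/
theorem uniformly_loud_past_of_inTableClass {ε₀ νh R : ℝ} {α : Fin 4 → Fin 4 → Fin 4 → ℤ × ℤ × ℤ → ℝ}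
    {W : ℤ → ℝ → Em 4} (hε : 0 < ε₀) (hε1 : ε₀ ≤ 1) (hα : InTableClass R α) (hW : IsEternalVisc ε₀ νh α W)
    (hU : UniformBound W) (hne : ∃ (n : ℤ) (σ : ℝ), W n σ ≠ 0) :
    ∃ σ₀ : ℝ, ∀ σ : ℝ, σ ≤ σ₀ → ∃ k : ℤ, 1 / 45056 < ‖W k σ‖ := by
  have hK : shiftConst α (0, 0, 0) + bigLam ε₀ * shiftConst α (0, 0, 1)
      + (bigLam ε₀)⁻¹ * (shiftConst α (1, 0, 0) + shiftConst α (0, 1, 0)) ≤ 704 :=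
    quadConst_le hε hε1 hα
  have h := uniformly_loud_past (by linarith) hW hU hK (by norm_num) hne
  norm_num at h
  exact h

/-- The class-uniform floor on the INVISCID class `IsEternal` (hypothesis class of `stub_inviscid` and of stmt-25646).
[cite: Tao2016AveragedNS, §4 Lemma 4.1 (4.8); cell theorem] -/
theorem uniformly_loud_past_of_inTableClass_inviscid {ε₀ R : ℝ} {α : Fin 4 → Fin 4 → Fin 4 → ℤ × ℤ × ℤ → ℝ}
    {W : ℤ → ℝ → Em 4} (hε : 0 < ε₀) (hε1 : ε₀ ≤ 1) (hα : InTableClass R α) (hW : IsEternal ε₀ α W)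
    (hU : UniformBound W) (hne : ∃ (n : ℤ) (σ : ℝ), W n σ ≠ 0) :
    ∃ σ₀ : ℝ, ∀ σ : ℝ, σ ≤ σ₀ → ∃ k : ℤ, 1 / 45056 < ‖W k σ‖ :=
  uniformly_loud_past_of_inTableClass hε hε1 hα hW.isEternalVisc hU hne

/-- **Filter form**: `∀ᶠ σ in atBot, ∃ k, ‖W_k(σ)‖ > 1/45056` for every non-trivial uniformly bounded admissible eternal
solution of an E₂(R) table (`0 < ε₀ ≤ 1`, any `ν̂ ≥ 0`). [cite: Tao2016AveragedNS, §4 Lemma 4.1 (4.8), §6.4; cell theorem] -/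
theorem eventually_loud_atBot {ε₀ νh R : ℝ} {α : Fin 4 → Fin 4 → Fin 4 → ℤ × ℤ × ℤ → ℝ}
    {W : ℤ → ℝ → Em 4} (hε : 0 < ε₀) (hε1 : ε₀ ≤ 1) (hα : InTableClass R α) (hW : IsEternalVisc ε₀ νh α W)
    (hU : UniformBound W) (hne : ∃ (n : ℤ) (σ : ℝ), W n σ ≠ 0) :
    ∀ᶠ σ in atBot, ∃ k : ℤ, 1 / 45056 < ‖W k σ‖ := by
  obtain ⟨σ₀, h⟩ := uniformly_loud_past_of_inTableClass hε hε1 hα hW hU hne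
  exact eventually_atBot.2 ⟨σ₀, h⟩

end WakeRatchetQuietPast

end Summit.NavierStokesRegularity.NavierStokesRegularity.Theorems

end
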